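import Literature.NumberTheory.DiophantineGeometry.AbcWave0
import Literature.NumberTheory.DiophantineGeometry.MultiplicativeGroupApproximation
import Mathlib.Analysis.SpecialFunctions.Pow.Real
import HarnessLib

/-!
# Subexponential `abc` without `rad(a)`, and the first unconditional bound towards the `abcd`
# conjecture (Pasten–Sepúlveda-Manzo 2025)

Topic `Literature/NumberTheory/DiophantineGeometry` (family `abc`, LADDER-ABC A1: linear forms in
logarithms; recent-theorem harvest of the cross-ladder literature-typing layer, seat lit-abc-pasten
g2, cell abc-stewartyu). Source: H. Pasten, R. Sepúlveda-Manzo, *On the `abc` and the `abcd`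
conjectures*, Bull. Braz. Math. Soc. (N.S.) **56** (2025) no. 4 = arXiv:2406.05083
[`PastenSepulvedaManzo2025Abcd`] (arXiv v1, 4 pp., READ in full). Notation (§1): `rad(n)` the
largest positive squarefree divisor of `n ≠ 0`; `log_k` the `k`-th iterated logarithm and
`log⁎_k(t) = log_k(t)` unless it is `< 1` or undefined, in which case `log⁎_k(t) = 1` — rendered with
the tree's `Dioph.logStar u = max 1 (log u)` (`MultiplicativeGroupApproximation.lean`) as
`log⁎₂ t = logStar (log t)`, `log⁎₃ t = logStar (log (log t))` (these agree with the printed convention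
for `t ≥ 1`); `psRate R = (log⁎₃ R / log⁎₂ R) · log R`, the rate in the exponent of (1.4)/(2.1).

## Contents

* `PastenSepulvedaManzo2025_thm_2_2` — NAMED FACT, Thm 2.2 (preliminary subexponential bound, ALL
  `abc` triples): `log(c/a) / log⁎₂ c ≤ exp(κ · psRate(rad(bc)))` with an absolute `κ > 0`. Printed
  proof: Lemma 2.1 (= Evertse–Győry Thm 4.2.1, in the tree for `K = ℚ` as the named fact
  `evertseGyory_thm_4_2_1_rat`) with `ξ = b/c`, `ξ_j` the primes of `bc`; AM–GM; `ω(R) ≤ M log R / log⁎₂ R`;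
  monotonicity of `t ↦ (K log R / t)^t` on `t ≤ K log R / e`. PROVED from the single named fact
  `evertseGyory_thm_4_2_1_rat` in the sibling `SubexponentialAbcWithoutRadAProofs.lean`
  (`PastenSepulvedaManzo2025_thm_2_2_of_evertseGyory`).
* `PastenSepulvedaManzo2025_thm_1_3` — Thm 1.3 (main theorem for `abc`), typed, and **PROVED** from
  Thm 2.2 (`PastenSepulvedaManzo2025_thm_1_3_of_thm_2_2`, the printed one-line proof): if
  `a ≤ c / exp((log c)^τ · log⁎₂ c)` for some `τ > 0` then `log c ≤ exp(τ⁻¹ κ · psRate(rad(bc)))` —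
  subexponential, and WITHOUT `rad(a)`.
* `PastenSepulvedaManzo2025_thm_1_6` — NAMED FACT, Thm 1.6 (subexponential bound for the `abcd`
  equation): for pairwise coprime non-zero `x₁ + x₂ + x₃ + x₄ = 0` with `H = max|x_j|` and
  `min_{i<j} |x_i + x_j| ≤ H / exp((log H)^τ log⁎₂ H)`, `log H ≤ exp(τ⁻¹ κ · psRate(rad(x₁x₂x₃x₄)))`.
  Per the authors (§1.4) no unconditional result for the `n`-term equation over `ℤ`, `n ≥ 4`, was
  known before. Printed proof (§3): reduction to Thm 1.3 on the triple `x₁ + x₂ = y` (with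
  `rad(x₁x₂) ≤ rad(x₁x₂x₃x₄)` and the monotonicity of `psRate`); PROVED from
  `evertseGyory_thm_4_2_1_rat` in the sibling proofs file
  (`PastenSepulvedaManzo2025_thm_1_6_of_evertseGyory`, via a general-`n` form of Thm 1.3 that
  avoids the monotonicity of `psRate`).

NOT TYPED: Thm 1.2 (= Pasten, Invent. Math. 236 (2024) Thm 1.4 (1); in the tree as
`Literature.Barriers.ABC.pasten2024_thm_1_4_1`), Conjectures 1.1/1.4/1.5 (conjectures are not
Literature), Lemma 2.1 (= `evertseGyory_thm_4_2_1_rat`). Faithfulness: Thm 2.2, Thm 1.3 FAITHFUL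
(verbatim displays; `a, b, c` coprime positive with `a + b = c` = `IsABCTriple a b c`, ordered so that
`a` is the member missing from the radical); Thm 1.6 FAITHFUL (`min_{i<j}|x_i + x_j| ≤ B` rendered as
`∃ i ≠ j, |x_i + x_j| ≤ B`; `H` = the maximum of the `|x_j|`). Typed ≠ endorsed; no claim on `abc`.

## References

* [PastenSepulvedaManzo2025Abcd] H. Pasten, R. Sepúlveda-Manzo, Bull. Braz. Math. Soc. 56 (2025) =
  arXiv:2406.05083: Thm 1.3 (§1.2), Thm 1.6 (§1.4), Lemma 2.1 and Thm 2.2 (§2), §3.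
* [EvertseGyory2015] J.-H. Evertse, K. Győry, *Unit Equations in Diophantine Number Theory*, CUP
  2015, Thm 4.2.1 (the input Lemma 2.1).
-/

noncomputable section

open Real

namespace Literature.NumberTheory.DiophantineGeometry

open Dioph

/-! ### The rate `(log⁎₃ R / log⁎₂ R) · log R` -/

/-- **The exponent rate of Pasten–Sepúlveda-Manzo** (displays (1.4), (2.1)):
`psRate R = (log⁎₃ R / log⁎₂ R) · log R` with `log⁎₂ R = logStar (log R) = max{1, log log R}` and
`log⁎₃ R = logStar (log log R)`. [cite: PastenSepulvedaManzo2025Abcd, Thm. 2.2 display (2.1) and §1.1 (the convention log⁎_k)] -/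
def psRate (R : ℝ) : ℝ :=
  logStar (Real.log (Real.log R)) / logStar (Real.log R) * Real.log R

/-- Unfolding lemma for `psRate`. [cite: PastenSepulvedaManzo2025Abcd, display (2.1)] -/
theorem psRate_def (R : ℝ) :
    psRate R = logStar (Real.log (Real.log R)) / logStar (Real.log R) * Real.log R :=
  rfl

/-- `logStar u > 0` (from the tree's `Dioph.one_le_logStar`). [folklore] -/
private theorem logStar_pos (u : ℝ) : 0 < logStar u :=
  lt_of_lt_of_le one_pos (Dioph.one_le_logStar u)

/-- `psRate R ≥ 0` for `R ≥ 1`. [cite: PastenSepulvedaManzo2025Abcd, display (2.1)] -/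
theorem psRate_nonneg {R : ℝ} (hR : 1 ≤ R) : 0 ≤ psRate R := by
  rw [psRate_def]
  exact mul_nonneg (div_nonneg (logStar_pos _).le (logStar_pos _).le) (Real.log_nonneg hR)

/-! ### Thm 2.2 (preliminary bound, all triples) — named fact -/

/-- NAMED FACT — **Pasten–Sepúlveda-Manzo 2025, Theorem 2.2** (preliminary subexponential bound for
`abc`). *"There is a constant `κ > 0` such that the following holds: Let `a, b, c` be coprime positive
integers with `a + b = c`. Then `log(c/a) / log⁎₂ c ≤ exp(κ · (log⁎₃ rad(bc) / log⁎₂ rad(bc)) · log rad(bc))`."*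
(`rad(bc)` = the radical in `ℕ` of `b·c`; note that `rad(a)` does not appear.) Printed proof: Lemma 2.1
(Evertse–Győry Thm 4.2.1; tree `evertseGyory_thm_4_2_1_rat`) with `ξ = b/c`, `ξ_j` the primes of
`bc`, AM–GM, `ω(rad) ≤ M log R / log⁎₂ R`, monotonicity of `(K log R/t)^t`. Users take
`(h : PastenSepulvedaManzo2025_thm_2_2)`; it is PROVED from `evertseGyory_thm_4_2_1_rat` as
`PastenSepulvedaManzo2025_thm_2_2_of_evertseGyory` (sibling `…Proofs.lean`).
[cite: PastenSepulvedaManzo2025Abcd, Thm. 2.2 (§2)] -/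
def PastenSepulvedaManzo2025_thm_2_2 : Prop :=
  ∃ κ : ℝ, 0 < κ ∧ ∀ a b c : ℕ, IsABCTriple a b c →
    Real.log ((c : ℝ) / a) / logStar (Real.log c) ≤
      Real.exp (κ * psRate (UniqueFactorizationMonoid.radical (M := ℕ) (b * c) : ℕ))

/-! ### Thm 1.3 (main theorem for `abc`), PROVED from Thm 2.2 -/

/-- **Pasten–Sepúlveda-Manzo 2025, Theorem 1.3 (Main theorem for `abc`)** — the statement. *"There is
a constant `κ > 0` such that the following holds. Let `a, b, c` be coprime positive integers with
`a + b = c` and suppose that for some `τ > 0` we have `a ≤ c / exp((log c)^τ log⁎₂ c)`. Then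
`log c ≤ exp(τ⁻¹ κ · (log⁎₃ rad(bc) / log⁎₂ rad(bc)) · log rad(bc))`. In particular, if `τ > 0` is
fixed, then we have `log c ≪_ε rad(bc)^ε` for every `ε > 0`."* (First display typed; `(log c)^τ` a
real power.) PROVED below from Thm 2.2. [cite: PastenSepulvedaManzo2025Abcd, Thm. 1.3 (§1.2)] -/
def PastenSepulvedaManzo2025_thm_1_3 : Prop :=
  ∃ κ : ℝ, 0 < κ ∧ ∀ a b c : ℕ, IsABCTriple a b c → ∀ τ : ℝ, 0 < τ →
    (a : ℝ) ≤ c / Real.exp ((Real.log c) ^ τ * logStar (Real.log c)) →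
      Real.log c ≤
        Real.exp (τ⁻¹ * κ * psRate (UniqueFactorizationMonoid.radical (M := ℕ) (b * c) : ℕ))

/-- **Thm 1.3 from Thm 2.2** (the printed proof, §2: *"The assumption (1.3) gives
`(log(c/a))/log⁎₂ c ≥ (log c)^τ` and the result follows from Theorem 2.2"*): with the same `κ`.
[cite: PastenSepulvedaManzo2025Abcd, Thm. 1.3 (proof, end of §2)] -/
theorem PastenSepulvedaManzo2025_thm_1_3_of_thm_2_2 (h : PastenSepulvedaManzo2025_thm_2_2) :
    PastenSepulvedaManzo2025_thm_1_3 := by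
  obtain ⟨κ, hκ, hb⟩ := h
  refine ⟨κ, hκ, fun a b c ht τ hτ hsmall => ?_⟩
  obtain ⟨ha, hb0, habc, hcop⟩ := ht
  set R : ℕ := UniqueFactorizationMonoid.radical (M := ℕ) (b * c) with hR
  set m : ℝ := logStar (Real.log c) with hm
  set E : ℝ := Real.exp (κ * psRate (R : ℕ)) with hE
  have hmpos : 0 < m := logStar_pos _
  have ha' : (0 : ℝ) < a := by exact_mod_cast ha
  have hc1 : (1 : ℝ) < c := by exact_mod_cast (show 1 < c by omega)
  have hc0 : (0 : ℝ) < c := by linarith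
  have hlogc : 0 < Real.log c := Real.log_pos hc1
  -- (1.3) gives `(log c)^τ · m ≤ log(c/a)`
  have hexp_pos : 0 < Real.exp ((Real.log c) ^ τ * m) := Real.exp_pos _
  have h1 : Real.exp ((Real.log c) ^ τ * m) ≤ (c : ℝ) / a := by
    rw [le_div_iff₀ ha']
    have := mul_le_mul_of_nonneg_right hsmall hexp_pos.le
    rw [div_mul_cancel₀ _ hexp_pos.ne'] at this
    linarith [mul_comm (a : ℝ) (Real.exp ((Real.log c) ^ τ * m))]
  have hca : 0 < (c : ℝ) / a := div_pos hc0 ha'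
  have h2 : (Real.log c) ^ τ * m ≤ Real.log ((c : ℝ) / a) :=
    (Real.le_log_iff_exp_le hca).mpr h1
  -- Thm 2.2 gives `log(c/a) ≤ E · m`, hence `(log c)^τ ≤ E`
  have h3 : Real.log ((c : ℝ) / a) / m ≤ E := hb a b c ⟨ha, hb0, habc, hcop⟩
  have h3' : Real.log ((c : ℝ) / a) ≤ E * m := by rwa [div_le_iff₀ hmpos] at h3
  have h4 : (Real.log c) ^ τ ≤ E := le_of_mul_le_mul_right (h2.trans h3') hmpos
  -- take `τ⁻¹`-th powers
  have h5 : ((Real.log c) ^ τ) ^ τ⁻¹ ≤ E ^ τ⁻¹ :=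
    Real.rpow_le_rpow (Real.rpow_nonneg hlogc.le τ) h4 (inv_nonneg.mpr hτ.le)
  rw [Real.rpow_rpow_inv hlogc.le hτ.ne'] at h5
  calc Real.log c ≤ E ^ τ⁻¹ := h5
    _ = Real.exp (τ⁻¹ * κ * psRate (R : ℕ)) := by
        rw [hE, ← Real.exp_mul]; ring_nf

/-! ### Thm 1.6: the `abcd` equation — named fact -/

/-- NAMED FACT — **Pasten–Sepúlveda-Manzo 2025, Theorem 1.6 (subexponential bound for the `abcd`
equation; the paper's title for it names the four-term problem).** *"There is an absolute constant `κ > 0` such that the following holds: Let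
`x₁, x₂, x₃, x₄` be pairwise coprime non-zero integers with `x₁ + x₂ + x₃ + x₄ = 0`. Let `H = max_j |x_j|`
and let us assume that for some `τ > 0` we have `min_{i<j} |x_i + x_j| ≤ H / exp((log H)^τ log⁎₂ H)`.
Then, writing `R = rad(x₁x₂x₃x₄)`, we have `log H ≤ exp(τ⁻¹ κ · (log⁎₃ R / log⁎₂ R) · log R)`. In
particular, if `τ > 0` is fixed, then for every `ε > 0` we have `log H ≪_ε rad(x₁x₂x₃x₄)^ε`."* (First
display typed.) Rendering: `x : Fin 4 → ℤ`, pairwise `IsCoprime`, `H = sup_j |x_j| ∈ ℕ`, the `min ≤`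
hypothesis as `∃ i ≠ j, |x_i + x_j| ≤ …`, `R` the radical in `ℕ` of `∏ |x_j|`. The authors note (§1.4)
that no unconditional result for the `n`-term equation over `ℤ` with `n ≥ 4` was previously known.
Printed proof (§3): WLOG the minimum is `|x₁ + x₂|` and `H ∈ {|x₁|, |x₃|}`; apply Thm 1.3 to the
coprime triple `x₁ + x₂ = y` (`c = H`, `a = |y|`), `rad(bc) = rad(x₁x₂) ≤ R`. Users take
`(h : PastenSepulvedaManzo2025_thm_1_6)`; it is PROVED from `evertseGyory_thm_4_2_1_rat` as
`PastenSepulvedaManzo2025_thm_1_6_of_evertseGyory` (sibling `…Proofs.lean`).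
[cite: PastenSepulvedaManzo2025Abcd, Thm. 1.6 (§1.4); proof §3] -/
def PastenSepulvedaManzo2025_thm_1_6 : Prop :=
  ∃ κ : ℝ, 0 < κ ∧ ∀ x : Fin 4 → ℤ, (∀ i, x i ≠ 0) → Pairwise (fun i j => IsCoprime (x i) (x j)) →
    ∑ i, x i = 0 → ∀ τ : ℝ, 0 < τ →
      (∃ i j : Fin 4, i ≠ j ∧
        (|((x i + x j : ℤ) : ℝ)|) ≤
          (Finset.univ.sup fun k => (x k).natAbs : ℕ) /
            Real.exp ((Real.log (Finset.univ.sup fun k => (x k).natAbs : ℕ)) ^ τ *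
              logStar (Real.log (Finset.univ.sup fun k => (x k).natAbs : ℕ)))) →
        Real.log (Finset.univ.sup fun k => (x k).natAbs : ℕ) ≤
          Real.exp (τ⁻¹ * κ *
            psRate (UniqueFactorizationMonoid.radical (M := ℕ) (∏ k, (x k).natAbs) : ℕ))

end Literature.NumberTheory.DiophantineGeometry

end
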